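import Summits.BirchSwinnertonDyer.BirchSwinnertonDyer.Theorems.SignedLowerHalvesSprungLowerDivisibilityAtThreeCyclotomicCertOfLambda
import HarnessLib

/-!
# One-point rigidity in a local ring and the cyclotomic points of `Λ = ℤ_p⟦T⟧` — the ALGEBRA of the
# one-deep-point squeeze (crux `KobayashiLowerHalfLargeImage`, item stmt-BirchSwinnertonDyer-19001;
# lead `bsd-line-slh-p1` gen 10; sibling `…LargeImageDeepPoint.lean` applies it to Kobayashi's objects)

ROUTE-INDEPENDENT, curve-free commutative algebra (no `Theses` import; `--supports
stmt-BirchSwinnertonDyer-19001 --as helper`; closes nothing; BSD is not proved by any of this).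

* §1 **One-point rigidity** (`isUnit_of_sup_span_le`, `isUnit_cofactor_of_pointCongruence`; adapted from
  the crux-ideate line `Cruxes/KobayashiLowerHalfLargeImage/Lines/rohrlich_squeeze.lean`, k1 g9, where
  they are proved in the same words): in a LOCAL ring, if `L = g·k` and `g + q·c = L·h` with `(q)` proper
  and `g` a non-zero-divisor modulo `q`, then the cofactor `k` is a UNIT — a divisibility that reverses at
  one point of `Spec Λ` is an equality up to units.
* §2 **The cyclotomic points** `Φ_{p^{n+1}}(1+T) ∈ Λ`, in the integral spelling
  `↑(((cyclotomic (p ^ (n+1)) ℤ).comp (X + 1)).map (Int.castRingHom ℤ_[p]))` of the line file and of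
  `IsCongrModOmega`. Primality in `Λ` and `λ(L) < φ(p^{n+1}) ⟹ Φ_{p^{n+1}}(1+T) ∤ L` are TREE THEOREMS,
  imported and cited (`Theorems.ChromaticCommonZeros.prime_cyclotomic_comp`,
  `….not_cyclotomic_comp_dvd_of_lam_lt`, over `Theorems.DefectPrime`); added here: the ideal is proper,
  non-multiples are non-zero-divisors modulo it, and DEEP POINTS EXIST for every `L ≠ 0` — at
  `n = λ(L) + 1`, since `φ(p^{λ+1}) ≥ 2^λ > λ` (`exists_not_coe_cyclotomic_dvd`).

References: [Washington1997] Prop. 7.2, §7.1, §13.2; [GreenbergLNM1716] §4 (the `T = 0` instance of §1).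
-/

set_option autoImplicit false
-- single-problem summit (D-0017): the doubled namespace component `BirchSwinnertonDyer` is by design
set_option linter.dupNamespace false

noncomputable section

open Polynomial Literature.NumberTheory.EllipticCurves Summit.BirchSwinnertonDyer.Rank1Residual.X1.MuLambda
  Summit.BirchSwinnertonDyer.BirchSwinnertonDyer.Theorems

namespace Summit.BirchSwinnertonDyer.BirchSwinnertonDyer.Theorems.LargeImageDeepPoint

/-! ## §1 One-point rigidity in a local ring -/

section Rigidity

variable {R : Type*} [CommRing R] [IsLocalRing R]

/-- **One-point rigidity, ideal form.** `R` local, `I ≠ ⊤` an ideal modulo which `a` is a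
non-zero-divisor. If `(I, a) ⊆ (I, a·h)` — i.e. `a·h ∣ a` in `R/I` — then `h` is a unit of `R`:
from `a = i + a h k` get `a (1 - k h) ∈ I`, so `1 - k h ∈ I ⊆ 𝔪`, so `k h ∉ 𝔪`.
(Adapted from `Cruxes/KobayashiLowerHalfLargeImage/Lines/rohrlich_squeeze.lean`, cruxidea k1 g9.) [folklore] -/
theorem isUnit_of_sup_span_le {I : Ideal R} (hI : I ≠ ⊤) {a h : R}
    (hnzd : ∀ r : R, a * r ∈ I → r ∈ I)
    (hle : I ⊔ Ideal.span {a} ≤ I ⊔ Ideal.span {a * h}) : IsUnit h := by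
  have ha : a ∈ I ⊔ Ideal.span {a * h} :=
    hle (Ideal.mem_sup_right (Ideal.mem_span_singleton_self a))
  obtain ⟨i, hi, y, hy, hiy⟩ := Submodule.mem_sup.mp ha
  obtain ⟨k, rfl⟩ := Ideal.mem_span_singleton'.mp hy
  have hmem : a * (1 - k * h) ∈ I := by
    have h1 : a * (1 - k * h) = i := by linear_combination (-1 : R) * hiy
    rw [h1]; exact hi
  have h1I : (1 - k * h) ∈ I := hnzd _ hmem
  have hkh : IsUnit (k * h) := by
    by_contra hnu
    have hm : k * h ∈ IsLocalRing.maximalIdeal R := (IsLocalRing.mem_maximalIdeal _).mpr hnu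
    have h1m : (1 - k * h) ∈ IsLocalRing.maximalIdeal R := IsLocalRing.le_maximalIdeal hI h1I
    have hone : (1 : R) ∈ IsLocalRing.maximalIdeal R := by
      have := Ideal.add_mem _ h1m hm
      rwa [sub_add_cancel] at this
    exact (Ideal.ne_top_iff_one _).mp (IsLocalRing.maximalIdeal.isMaximal R).ne_top hone
  exact isUnit_of_mul_isUnit_right hkh

/-- **One-point rigidity, congruence form.** In a local ring let `q` generate a proper ideal modulo
which `g` is a non-zero-divisor. If `L = g·k` (Kato's divisibility) and `g + q·c = L·h` (the reverse
divisibility AT THE POINT `q`), then the cofactor `k` is a unit.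
(Adapted from `Lines/rohrlich_squeeze.lean`, cruxidea k1 g9.) [folklore] -/
theorem isUnit_cofactor_of_pointCongruence {q g L k h c : R}
    (hq : Ideal.span {q} ≠ ⊤) (hnzd : ∀ r : R, g * r ∈ Ideal.span {q} → r ∈ Ideal.span {q})
    (hkato : L = g * k) (hpoint : g + q * c = L * h) : IsUnit k := by
  refine isUnit_of_sup_span_le hq hnzd ?_
  have hg : g ∈ Ideal.span {q} ⊔ Ideal.span {g * k} := by
    have hgq : g = (g * k) * h + q * (-c) := by linear_combination hpoint + h * hkato
    have hmem : (g * k) * h + q * (-c) ∈ Ideal.span {q} ⊔ Ideal.span {g * k} :=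
      Ideal.add_mem _ (Ideal.mem_sup_right (Ideal.mul_mem_right _ _ (Ideal.mem_span_singleton_self _)))
        (Ideal.mem_sup_left (Ideal.mul_mem_right _ _ (Ideal.mem_span_singleton_self _)))
    rwa [← hgq] at hmem
  exact sup_le le_sup_left ((Ideal.span_singleton_le_iff_mem _).mpr hg)

end Rigidity

/-! ## §2 The cyclotomic points `Φ_{p^{n+1}}(1+T)` of `Λ = ℤ_p⟦T⟧` -/

section CyclotomicPoint

variable (p : ℕ) [hp : Fact p.Prime]

/-- The ideal `(Φ_{p^{n+1}}(1+T)) ⊂ Λ` is proper (its generator is prime — tree theorem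
`ChromaticCommonZeros.prime_cyclotomic_comp` — hence not a unit). [cite: Washington1997, §13.2] -/
theorem span_coe_cyclotomic_ne_top (n : ℕ) :
    Ideal.span {((((cyclotomic (p ^ (n + 1)) ℤ).comp (X + 1)).map (Int.castRingHom ℤ_[p]) :
      ℤ_[p][X]) : PowerSeries ℤ_[p])} ≠ ⊤ := by
  rw [Ne, Ideal.span_singleton_eq_top]
  exact (ChromaticCommonZeros.prime_cyclotomic_comp (p := p) n).not_unit

/-- Non-zero-divisor form: if `Φ_{p^{n+1}}(1+T) ∤ g` then `g` is a non-zero-divisor modulo `Φ`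
(`Λ/(Φ)` is a domain, `Φ` being prime — `ChromaticCommonZeros.prime_cyclotomic_comp`).
[cite: Washington1997, Prop. 7.2 and §13.2] -/
theorem mem_span_coe_cyclotomic_of_mul_mem (n : ℕ) {g : PowerSeries ℤ_[p]}
    (hg : ¬ ((((cyclotomic (p ^ (n + 1)) ℤ).comp (X + 1)).map (Int.castRingHom ℤ_[p]) :
      ℤ_[p][X]) : PowerSeries ℤ_[p]) ∣ g) (r : PowerSeries ℤ_[p])
    (hr : g * r ∈ Ideal.span {((((cyclotomic (p ^ (n + 1)) ℤ).comp (X + 1)).map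
      (Int.castRingHom ℤ_[p]) : ℤ_[p][X]) : PowerSeries ℤ_[p])}) :
    r ∈ Ideal.span {((((cyclotomic (p ^ (n + 1)) ℤ).comp (X + 1)).map
      (Int.castRingHom ℤ_[p]) : ℤ_[p][X]) : PowerSeries ℤ_[p])} := by
  rw [Ideal.mem_span_singleton] at hr ⊢
  exact ((ChromaticCommonZeros.prime_cyclotomic_comp (p := p) n).dvd_or_dvd hr).resolve_left hg

/-- **Deep points exist**: every `L ≠ 0` in `Λ` has a cyclotomic point `Φ_n` (`n ≥ 1`) with `Φ_n ∤ L`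
— namely `n = λ(L) + 1`, since `φ(p^{λ+1}) ≥ 2^λ > λ` and `λ(L) < φ(p^n) ⟹ Φ_n ∤ L` (tree theorem
`ChromaticCommonZeros.not_cyclotomic_comp_dvd_of_lam_lt`). For `L = L^ε_p` this replaces Rohrlich's
non-vanishing theorem in the converse of the squeeze. [cite: Washington1997, §7.1] -/
theorem exists_not_coe_cyclotomic_dvd {L : IwasawaAlgebra p} (hL : L ≠ 0) :
    ∃ n : ℕ, 1 ≤ n ∧ ¬ ((((cyclotomic (p ^ n) ℤ).comp (X + 1)).map (Int.castRingHom ℤ_[p]) :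
      ℤ_[p][X]) : IwasawaAlgebra p) ∣ L := by
  refine ⟨lam L + 1, Nat.succ_pos _,
    ChromaticCommonZeros.not_cyclotomic_comp_dvd_of_lam_lt hL (lam L) ?_⟩
  rw [Nat.totient_prime_pow_succ hp.out]
  have h2 : 2 ≤ p := hp.out.two_le
  have hpow : lam L < 2 ^ lam L := Nat.lt_two_pow_self
  have hmono : 2 ^ lam L ≤ p ^ lam L := Nat.pow_le_pow_left h2 _
  have h1 : 1 ≤ p - 1 := by omega
  calc lam L < p ^ lam L := lt_of_lt_of_le hpow hmono
    _ = p ^ lam L * 1 := (mul_one _).symm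
    _ ≤ p ^ lam L * (p - 1) := Nat.mul_le_mul_left _ h1

end CyclotomicPoint

end Summit.BirchSwinnertonDyer.BirchSwinnertonDyer.Theorems.LargeImageDeepPoint

end
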